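import Literature.NumberTheory.Sieve.HeathBrownCubicMertensK
import Literature.NumberTheory.Sieve.HeathBrownCubicTypeII
import Literature.NumberTheory.Sieve.HeathBrownCubicTypeIMoebius
import Literature.NumberTheory.LFunctions.IdealMoebiusCoprime
import Mathlib.NumberTheory.EulerProduct.Basic
import Mathlib.Analysis.SpecificLimits.Normed
import HarnessLib

/-!
# Heath-Brown's `Σ₁ = (π²/6)σ₀ + O(exp{−c(log L)^{1/2}})` (the singular-series sum in the proof of Lemma 3.9)

Pure-proof file (theorems, plus the auxiliary coefficient sequences as `def`s with their unfolding
lemmas; no named facts) in the decomposition of **parity.S18**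
(`Literature.NumberTheory.Sieve.setOf_prime_cube_add_two_mul_cube_infinite`) along D. R. Heath-Brown,
*Primes represented by `x³ + 2y³`*, Acta Math. 186 (2001), 1–84, towards the named fact
`HeathBrown2001_lemma_3_9` (`HeathBrownCubicTypeII`; its `ℬ`-half (10.5) is proved in
`HeathBrownCubicLeadingB`, and Lemma 3.9 is reduced there to the `𝒜`-half (10.4)). In the proof of
(10.4) (§10, pp. 62–63) the main term produced by the Type I bound Lemma 3.2 is
`(6η²X²/π²) ∑_R c_R w'(3X³/N(R))/(M(ξ log X)^{n+1}N(R)) ρ₂(R) Σ₁` with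

  `Σ₁ = ∑_{J ∈ 𝒯r, N(J) < L} μ(J) ρ₂(J) N(J)^{-1} log(L/N(J))`,

and Heath-Brown evaluates (p. 62: "we set `N(J) = q`, and observe that `μ(J) = μ(q)` and
`ρ₂(J) = … ρ₀(q)/ν…`. Thus `Σ₁ = ∑_{q ≤ L} ρ₀(q)μ(q)q^{-1}log(L/q)`. We therefore define a Dirichlet series
`f(s) = ∑ ρ₀(q)μ(q)q^{-s}`, and conclude from Perron's formula that `Σ₁ = (1/2πi)∫ f(s+1)L^s s^{-2}ds`.
However, `f(s) = ζ_K(s)^{-1}f₀(s)`, where `f₀(s)` has an Euler product which converges absolutely and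
uniformly for `Re(s) ≥ 3/4`, say … using standard results on the zero-free region …
`Σ₁ = Res{f(s+1)L^s s^{-2} : s = 0} + O(exp{−c(log L)^{1/2}}) = γ₀^{-1}f₀(1) + O(…) = … = (π²/6)σ₀ + O(exp{−c(log L)^{1/2}})`,
where `γ₀` is the residue of `ζ_K(s)` at `s = 1`, as usual").

This file PROVES that evaluation (`HeathBrown2001_sigmaOne_bound`, `HeathBrown2001_sigmaOne_bound'`):
for `σ₀` the limit of the ordered partial products `singularProductPartial` of the singular series
(`σ₀ = ∏_p(1 − (ν_p − 1)/p)`, p. 2), there are `c, C > 0` with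
`|Σ₁(x) − (π²/6)σ₀| ≤ C exp(−c√(log x))` for all `x ≥ 1`.

## The proof

* §A `sum_range_le_prod_tsum`, `summable_of_prod_tsum_le` — a non-negative multiplicative function
  with summable local factors and bounded finite Euler products is summable (Mathlib's
  `EulerProduct.summable_and_hasSum_factoredNumbers_prod_filter_prime_tsum`, which needs LOCAL
  summability only).
* §B `sigmaOneCoeff = a`, `a(q) = μ(q)∏_{p∣q}ρ₀(p)` (`ρ₀` of Lemma 2.1, `HeathBrownCubicFLSequencesA.rho₀`),
  `normCountAF = c_K`, `sigmaOneNum = h = a ⋆ c_K` (all multiplicative); `h(p) = ν_p/(p+1)`,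
  `h(p^e) = c_K(p^e) − ρ₀(p)c_K(p^{e−1})`, `|h(p^e)| ≤ 4(e+1)³`.
* §C `summable_sigmaOneF` — `∑ |h(n)| n^{-3/4} ≤ B_h < ∞` ("`f₀` converges absolutely for `Re s ≥ 3/4`"):
  local factors `≤ 1 + (3 + T₀)p^{-3/2}`, `T₀ = ∑_e 4(e+3)³(3/4)^e`.
* §D `LSeries_sigmaOneCoeff_mul_dedekindZeta` (`f·ζ_K = f₀` on `Re s > 1`) and
  `sigmaOne_logRieszMean_bound`: the tree's Perron-formula-with-zero-free-region theorem
  `LFunctions.NumberField.logRieszMean_LSeries_div_dedekindZeta_bound` (`RieszMeanInvDedekindZeta`) with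
  `σ_h = 3/4`: `|∑_{n≤x} a(n)n^{-1}log(x/n) − f₀(1)/γ₀| ≤ C exp(−c√(log x))`.
* §E the residue `f₀(1) = ∑_n h(n)/n = σ₀γ₀π²/6` (`tsum_sigmaOneQuot_eq`): Euler product
  (`ArithmeticFunction.IsMultiplicative.eulerProduct`), local factors
  `∑_e h(p^e)p^{-e} = (1 − ρ₀(p)/p)∏_{P∣p}(1 − N(P)^{-1})^{-1}` (the tree's finite Euler product over the
  ideals supported above `p`, `IdealMoebiusCoprime.hasSum_card_supported_mul_rpow`), so that the partial
  products are `V_𝒜(N)/V_ℬ(N)` (`HeathBrownCubicFLProducts.prodA/prodB`), whose limit is `σ₀γ₀π²/6` by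
  (6.7) (`prodA_eq`: `V_𝒜 = S·V·∏(1−p^{-2})^{-1}`), `∏_{p<N}(1−p^{-2}) → 6/π²` (`tendsto_invSqProdNat`),
  Mertens (`abs_mertensProd_mul_sub_one_le`) and Mertens for `K` (`mertensK_grouped`).
* §F `idealMoebius_eq_moebius_absNorm` (`μ(J) = μ(N(J))` for `N(J)` square-free), `sigmaOne_sum_eq`
  (grouping by `q = N(J)`, `∑_{N(J)=q}ρ₂(J)/N(J) = ρ₀(q)/q`, `sum_normEq_rho₂_div_eq_densA`), and the
  theorem.

## References

* D. R. Heath-Brown, *Primes represented by `x³ + 2y³`*, Acta Math. 186 (2001), 1–84: §10, pp. 62–63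
  (the sum `Σ₁`), Lemma 2.1 (`ρ₀`), (6.7). [cite: HeathBrownActa2001, §10 pp. 62–63]
* H. L. Montgomery, R. C. Vaughan, *Multiplicative Number Theory I*, CUP 2007, §6.2 (the method, `K = ℚ`).
  [cite: MontgomeryVaughan2007, §6.2]

## Mathlib / tree search

Mathlib: `EulerProduct.summable_and_hasSum_factoredNumbers_prod_filter_prime_tsum`,
`ArithmeticFunction.IsMultiplicative.eulerProduct`, `IsMultiplicative.mul/.pmul/.prodPrimeFactors/.intCast`,
`isMultiplicative_moebius`, `moebius_apply_prime_pow`, `moebius_apply_of_squarefree`,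
`cardDistinctFactors_eq_cardFactors_iff_squarefree`, `Nat.divisors_prime_pow`, `Nat.sum_divisorsAntidiagonal`,
`summable_pow_mul_geometric_of_norm_lt_one`, `summable_of_sum_range_le`, `Real.tsum_le_of_sum_range_le`,
`LSeries_convolution'`, `LSeries.norm_term_eq`, `Nat.eq_prime_pow_of_unique_prime_dvd`,
`Function.Injective.hasSum_iff`, `hasSum_nat_add_iff'`, `squeeze_zero_norm'`. Tree:
`LFunctions.NumberField.logRieszMean_LSeries_div_dedekindZeta_bound`, `LSeriesSummable_idealNormCount`,
`dedekindZeta_eq_LSeries`, `idealNormCount_mul_of_coprime`, `idealNormCount_prime_pow_le`,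
`LFunctions.NumberField.hasSum_card_supported_mul_rpow`, `CubicSieve.rho₀`, `densA`, `densA_prime`,
`normEq`, `sum_normEq_rho₂_div_eq_densA`, `idealNormCount_eq_prod_of_squarefree`,
`normSimple_of_squarefree_absNorm`, `NormSimple.image_absNorm_primeFactorsFinset`,
`squarefree_of_squarefree_absNorm`, `prodA`, `prodB`, `prodA_eq`, `prodB_pos_le`, `mertensProd`,
`abs_mertensProd_mul_sub_one_le`, `invSqProd_eq`, `tendsto_invSqProdNat`, `mertensK_grouped`,
`normDensityAt`, `primesAbove`, `mem_primesAbove_iff`, `exists_absNorm_eq_pow_of_mem_primesAbove`,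
`singularProductPartial`, `gamma₀`, `cubeRootTwoCount_le_three`, `finrank_K`. Searched for an existing
evaluation of Möbius-type sums twisted by `ρ₂`/`ρ₀` (`lean search 'rho₀.*moebius|sigmaOne|Sigma1|Σ₁'`):
none; `IdealMoebius.idealMoebius_logRieszMean_bound` and `IdealMoebiusCoprime.coprimeMoebius_logRieszMean_bound`
are the untwisted cases `h = δ`, `h = h_𝔠`.
-/

noncomputable section

open NumberField Finset Filter Topology
open scoped ArithmeticFunction.Moebius

namespace Literature.NumberTheory.Sieve.CubicSieve

open LFunctions.CubeRootTwoField CubicPrimes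
open Literature.NumberTheory.LFunctions (idealNormCount)

/-! ### A. Non-negative multiplicative functions: summability from local data -/

section EulerBound

/-- For `f ≥ 0` on `ℕ` with `f 0 = 0`, `f 1 = 1`, multiplicative on coprime arguments and summable
on the powers of every prime: `∑_{n < N} f(n) ≤ ∏_{p < N} ∑_e f(p^e)` (every `0 < n < N` is a
product of powers of primes `< N`; Mathlib's finite Euler product over the `primesBelow N`-factored
numbers, `EulerProduct.summable_and_hasSum_factoredNumbers_prod_filter_prime_tsum`). [folklore] -/
theorem sum_range_le_prod_tsum {f : ℕ → ℝ} (hf0 : ∀ n, 0 ≤ f n) (hf00 : f 0 = 0) (hf₁ : f 1 = 1)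
    (hmul : ∀ {m n : ℕ}, Nat.Coprime m n → f (m * n) = f m * f n)
    (hloc : ∀ {p : ℕ}, p.Prime → Summable fun e : ℕ => f (p ^ e)) (N : ℕ) :
    ∑ n ∈ Finset.range N, f n ≤ ∏ p ∈ Nat.primesBelow N, ∑' e : ℕ, f (p ^ e) := by
  have hloc' : ∀ {p : ℕ}, p.Prime → Summable fun e : ℕ => ‖f (p ^ e)‖ := fun hp =>
    (hloc hp).congr fun e => (Real.norm_of_nonneg (hf0 _)).symm
  obtain ⟨-, hsum⟩ :=
    EulerProduct.summable_and_hasSum_factoredNumbers_prod_filter_prime_tsum hf₁ hmul hloc'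
      (Nat.primesBelow N)
  have hfilter : (Nat.primesBelow N).filter Nat.Prime = Nat.primesBelow N :=
    Finset.filter_true_of_mem fun p hp => (Nat.mem_primesBelow.1 hp).2
  rw [hfilter] at hsum
  have hmem : ∀ n ∈ (Finset.range N).filter (· ≠ 0),
      n ∈ Nat.factoredNumbers (Nat.primesBelow N) := by
    intro n hn
    rw [Finset.mem_filter, Finset.mem_range] at hn
    refine Nat.mem_factoredNumbers_of_primeFactors_subset hn.2 fun p hp => ?_
    have hp' := Nat.mem_primeFactors.1 hp
    exact Nat.mem_primesBelow.2
      ⟨(Nat.le_of_dvd (Nat.pos_of_ne_zero hn.2) hp'.2.1).trans_lt hn.1, hp'.1⟩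
  calc ∑ n ∈ Finset.range N, f n
      = ∑ n ∈ (Finset.range N).filter (· ≠ 0), f n := by
        rw [Finset.sum_filter_of_ne]
        intro n _ hne h0
        exact hne (by rw [h0, hf00])
    _ = ∑ n ∈ ((Finset.range N).filter (· ≠ 0)).filter
          (· ∈ Nat.factoredNumbers (Nat.primesBelow N)), f n := by
        rw [Finset.filter_true_of_mem hmem]
    _ = ∑ m ∈ ((Finset.range N).filter (· ≠ 0)).subtype
          (· ∈ Nat.factoredNumbers (Nat.primesBelow N)), f (m : ℕ) := by
        rw [← Finset.subtype_map, Finset.sum_map]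
        rfl
    _ ≤ _ := sum_le_hasSum _ (fun m _ => hf0 _) hsum

/-- Summability of a non-negative multiplicative `f` from a uniform bound `∏_{p<N} ∑_e f(p^e) ≤ M`
for its finite Euler products, with `∑ f ≤ M`. [folklore] -/
theorem summable_of_prod_tsum_le {f : ℕ → ℝ} (hf0 : ∀ n, 0 ≤ f n) (hf00 : f 0 = 0)
    (hf₁ : f 1 = 1) (hmul : ∀ {m n : ℕ}, Nat.Coprime m n → f (m * n) = f m * f n)
    (hloc : ∀ {p : ℕ}, p.Prime → Summable fun e : ℕ => f (p ^ e)) {M : ℝ}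
    (hM : ∀ N : ℕ, ∏ p ∈ Nat.primesBelow N, ∑' e : ℕ, f (p ^ e) ≤ M) :
    Summable f ∧ ∑' n, f n ≤ M :=
  have key : ∀ N, ∑ n ∈ Finset.range N, f n ≤ M := fun N =>
    (sum_range_le_prod_tsum hf0 hf00 hf₁ hmul hloc N).trans (hM N)
  ⟨summable_of_sum_range_le hf0 key, Real.tsum_le_of_sum_range_le hf0 key⟩

end EulerBound

/-! ### B. The coefficients `a(q) = μ(q)∏_{p∣q}ρ₀(p)`, `c_K`, and `h = a ⋆ c_K` -/

/-- `c_K(n)`, the number of ideals of `𝓞_K` of norm `n`, as a real arithmetic function (value `0`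
at `n = 0`). [folklore] -/
def normCountAF : ArithmeticFunction ℝ :=
  ⟨fun n => if n = 0 then 0 else (idealNormCount K n : ℝ), if_pos rfl⟩

/-- `normCountAF n = c_K(n)` for `n ≠ 0`. [folklore] -/
theorem normCountAF_apply {n : ℕ} (hn : n ≠ 0) : normCountAF n = idealNormCount K n := if_neg hn

/-- `normCountAF ≥ 0`. [folklore] -/
theorem normCountAF_nonneg (n : ℕ) : 0 ≤ normCountAF n := by
  rcases eq_or_ne n 0 with rfl | hn
  · simp
  · rw [normCountAF_apply hn]; exact Nat.cast_nonneg _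

/-- `c_K` is multiplicative. [folklore] -/
theorem isMultiplicative_normCountAF : normCountAF.IsMultiplicative := by
  refine ⟨by rw [normCountAF_apply one_ne_zero, LFunctions.idealNormCount_one]; simp, ?_⟩
  intro m n hmn
  rcases eq_or_ne m 0 with rfl | hm
  · simp
  rcases eq_or_ne n 0 with rfl | hn
  · simp
  rw [normCountAF_apply (mul_ne_zero hm hn), normCountAF_apply hm, normCountAF_apply hn,
    LFunctions.idealNormCount_mul_of_coprime K hmn, Nat.cast_mul]

/-- `c_K(p) = ν_p` at a prime. [folklore] -/
theorem idealNormCount_prime_eq {p : ℕ} (hp : p.Prime) : idealNormCount K p = cubeRootTwoCount p := by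
  rw [idealNormCount_eq_prod_of_squarefree hp.squarefree, hp.primeFactors, prod_singleton]

/-- Heath-Brown's coefficients `ρ₀(q)μ(q)` of the Dirichlet series `f(s) = ∑ ρ₀(q)μ(q)q^{-s}`
(p. 62), `ρ₀` the multiplicative function of Lemma 2.1: the real arithmetic function
`a(q) = μ(q) ∏_{p ∣ q} ρ₀(p)`. [cite: HeathBrownActa2001, §10 p. 62] -/
def sigmaOneCoeff : ArithmeticFunction ℝ :=
  (ArithmeticFunction.moebius : ArithmeticFunction ℝ).pmul
    (ArithmeticFunction.prodPrimeFactors fun p => rho₀ p)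

/-- `a` is multiplicative. [folklore] -/
theorem isMultiplicative_sigmaOneCoeff : sigmaOneCoeff.IsMultiplicative :=
  ArithmeticFunction.isMultiplicative_moebius.intCast.pmul
    (ArithmeticFunction.IsMultiplicative.prodPrimeFactors _)

/-- `a(n) = μ(n)∏_{p∣n}ρ₀(p)` for `n ≠ 0`. [cite: HeathBrownActa2001, §10 p. 62] -/
theorem sigmaOneCoeff_apply {n : ℕ} (hn : n ≠ 0) :
    sigmaOneCoeff n = (μ n : ℝ) * ∏ p ∈ n.primeFactors, rho₀ p := by
  rw [sigmaOneCoeff, ArithmeticFunction.pmul_apply, ArithmeticFunction.intCoe_apply,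
    ArithmeticFunction.prodPrimeFactors_apply hn]

/-- `a(p) = −ρ₀(p)`. [cite: HeathBrownActa2001, §10 p. 62] -/
theorem sigmaOneCoeff_prime {p : ℕ} (hp : p.Prime) : sigmaOneCoeff p = -rho₀ p := by
  rw [sigmaOneCoeff_apply hp.ne_zero, hp.primeFactors, prod_singleton,
    ArithmeticFunction.moebius_apply_prime hp]
  push_cast
  ring

/-- `a(p^k) = 0` for `k ≥ 2`. [folklore] -/
theorem sigmaOneCoeff_prime_pow {p : ℕ} (hp : p.Prime) {k : ℕ} (hk : 2 ≤ k) :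
    sigmaOneCoeff (p ^ k) = 0 := by
  rw [sigmaOneCoeff_apply (pow_ne_zero _ hp.ne_zero),
    ArithmeticFunction.moebius_apply_prime_pow hp (by omega), if_neg (by omega)]
  simp

/-- `a(n) = 0` unless `n` is square-free. [folklore] -/
theorem sigmaOneCoeff_eq_zero_of_not_squarefree {n : ℕ} (hn : ¬Squarefree n) :
    sigmaOneCoeff n = 0 := by
  rcases eq_or_ne n 0 with rfl | h0
  · simp
  rw [sigmaOneCoeff_apply h0, ArithmeticFunction.moebius_eq_zero_of_not_squarefree hn]
  simp

/-- `0 ≤ ρ₀(p) ≤ ν_p ≤ 3` at a prime. [folklore] -/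
theorem rho₀_le_cubeRootTwoCount (p : ℕ) : rho₀ p ≤ cubeRootTwoCount p := by
  rw [rho₀]
  exact div_le_self (Nat.cast_nonneg _) (le_add_of_nonneg_right (inv_nonneg.2 (Nat.cast_nonneg _)))

/-- `ρ₀(p) ≤ 3` at a prime. [folklore] -/
theorem rho₀_le_three {p : ℕ} (hp : p.Prime) : rho₀ p ≤ 3 :=
  (rho₀_le_cubeRootTwoCount p).trans (by exact_mod_cast cubeRootTwoCount_le_three hp)

/-- `|a(n)| ≤ c_K(n)`: for square-free `n`, `∏_{p∣n}ρ₀(p) ≤ ∏_{p∣n}ν_p = c_K(n)`. [folklore] -/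
theorem abs_sigmaOneCoeff_le (n : ℕ) : |sigmaOneCoeff n| ≤ normCountAF n := by
  rcases eq_or_ne n 0 with rfl | h0
  · simp
  by_cases hsq : Squarefree n
  · rw [sigmaOneCoeff_apply h0, normCountAF_apply h0, idealNormCount_eq_prod_of_squarefree hsq,
      abs_mul, Nat.cast_prod]
    have hμ : |(μ n : ℝ)| ≤ 1 := by exact_mod_cast ArithmeticFunction.abs_moebius_le_one
    have hprod : |∏ p ∈ n.primeFactors, rho₀ p| ≤ ∏ p ∈ n.primeFactors, (cubeRootTwoCount p : ℝ) := by
      rw [abs_of_nonneg (prod_nonneg fun p _ => rho₀_nonneg p)]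
      exact prod_le_prod (fun p _ => rho₀_nonneg p) fun p _ => rho₀_le_cubeRootTwoCount p
    have h0' : 0 ≤ ∏ p ∈ n.primeFactors, (cubeRootTwoCount p : ℝ) :=
      prod_nonneg fun p _ => Nat.cast_nonneg _
    calc |(μ n : ℝ)| * |∏ p ∈ n.primeFactors, rho₀ p|
        ≤ 1 * ∏ p ∈ n.primeFactors, (cubeRootTwoCount p : ℝ) :=
          mul_le_mul hμ hprod (abs_nonneg _) zero_le_one
      _ = _ := one_mul _
  · rw [sigmaOneCoeff_eq_zero_of_not_squarefree hsq, abs_zero]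
    exact normCountAF_nonneg n

/-- The numerator coefficients `h = a ⋆ c_K` of `f(s)ζ_K(s) = f₀(s)` ("`f(s) = ζ_K(s)^{-1}f₀(s)`,
where `f₀(s)` has an Euler product which converges absolutely … for `Re(s) ≥ 3/4`", p. 63).
[cite: HeathBrownActa2001, §10 p. 63] -/
def sigmaOneNum : ArithmeticFunction ℝ := sigmaOneCoeff * normCountAF

/-- `h` is multiplicative. [folklore] -/
theorem isMultiplicative_sigmaOneNum : sigmaOneNum.IsMultiplicative :=
  isMultiplicative_sigmaOneCoeff.mul isMultiplicative_normCountAF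

/-- `h(1) = 1`. [folklore] -/
theorem sigmaOneNum_one : sigmaOneNum 1 = 1 := isMultiplicative_sigmaOneNum.map_one

/-- **`h(p^e) = c_K(p^e) − ρ₀(p)c_K(p^{e−1})`** for `e ≥ 1` (`a(p^i) = 0` for `i ≥ 2`). [folklore] -/
theorem sigmaOneNum_prime_pow {p : ℕ} (hp : p.Prime) {e : ℕ} (he : e ≠ 0) :
    sigmaOneNum (p ^ e) =
      (idealNormCount K (p ^ e) : ℝ) - rho₀ p * idealNormCount K (p ^ (e - 1)) := by
  rw [sigmaOneNum, ArithmeticFunction.mul_apply,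
    Nat.sum_divisorsAntidiagonal (fun i j => sigmaOneCoeff i * normCountAF j),
    Nat.divisors_prime_pow hp, Finset.sum_map]
  have hvan : ∀ i ∈ Finset.range (e + 1), i ∉ Finset.range 2 →
      sigmaOneCoeff ((⟨(p ^ ·), Nat.pow_right_injective hp.two_le⟩ : ℕ ↪ ℕ) i) *
        normCountAF (p ^ e / (⟨(p ^ ·), Nat.pow_right_injective hp.two_le⟩ : ℕ ↪ ℕ) i) = 0 := by
    intro i _ hi
    rw [Finset.mem_range, not_lt] at hi
    simp only [Function.Embedding.coeFn_mk]
    rw [sigmaOneCoeff_prime_pow hp hi, zero_mul]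
  have hsub : Finset.range 2 ⊆ Finset.range (e + 1) := Finset.range_subset_range.2 (by omega)
  rw [← Finset.sum_subset hsub hvan, Finset.sum_range_succ, Finset.sum_range_one]
  simp only [Function.Embedding.coeFn_mk, pow_zero, pow_one, Nat.div_one]
  rw [isMultiplicative_sigmaOneCoeff.map_one, one_mul, sigmaOneCoeff_prime hp,
    normCountAF_apply (pow_ne_zero _ hp.ne_zero)]
  have hdiv : p ^ e / p = p ^ (e - 1) := by
    have h : p ^ e / p ^ 1 = p ^ (e - 1) := Nat.pow_div (Nat.one_le_iff_ne_zero.2 he) hp.pos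
    rwa [pow_one] at h
  rw [hdiv, normCountAF_apply (pow_ne_zero _ hp.ne_zero)]
  ring

/-- `h(p) = ν_p/(p + 1)`. [cite: HeathBrownActa2001, §10 p. 63] -/
theorem sigmaOneNum_prime {p : ℕ} (hp : p.Prime) :
    sigmaOneNum p = (cubeRootTwoCount p : ℝ) / (p + 1) := by
  have h := sigmaOneNum_prime_pow hp one_ne_zero
  rw [pow_one, Nat.sub_self, pow_zero, LFunctions.idealNormCount_one, idealNormCount_prime_eq hp] at h
  have hp0 : (0 : ℝ) < p := by exact_mod_cast hp.pos
  rw [h, rho₀_eq hp.pos]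
  field_simp
  ring

/-- **`|h(p^e)| ≤ 4(e+1)³`** (`c_K(p^e) ≤ (e+1)³`, `ρ₀(p) ≤ 3`). [folklore] -/
theorem abs_sigmaOneNum_prime_pow_le {p : ℕ} (hp : p.Prime) (e : ℕ) :
    |sigmaOneNum (p ^ e)| ≤ 4 * ((e : ℝ) + 1) ^ 3 := by
  rcases eq_or_ne e 0 with rfl | he
  · rw [pow_zero, sigmaOneNum_one]; norm_num
  rw [sigmaOneNum_prime_pow hp he]
  have h1 := LFunctions.idealNormCount_prime_pow_le K p e hp
  have h2 := LFunctions.idealNormCount_prime_pow_le K p (e - 1) hp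
  rw [finrank_K] at h1 h2
  have he1 : ((e - 1 : ℕ) : ℝ) + 1 = e := by
    rw [Nat.cast_sub (Nat.one_le_iff_ne_zero.2 he)]; push_cast; ring
  rw [he1] at h2
  have hρ := rho₀_le_three hp
  have hρ0 := rho₀_nonneg p
  have hc0 : (0 : ℝ) ≤ idealNormCount K (p ^ (e - 1)) := Nat.cast_nonneg _
  have hc0' : (0 : ℝ) ≤ idealNormCount K (p ^ e) := Nat.cast_nonneg _
  have he0 : (0 : ℝ) ≤ e := Nat.cast_nonneg _
  calc |(idealNormCount K (p ^ e) : ℝ) - rho₀ p * idealNormCount K (p ^ (e - 1))|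
      ≤ |(idealNormCount K (p ^ e) : ℝ)| + |rho₀ p * idealNormCount K (p ^ (e - 1))| :=
        abs_sub _ _
    _ = idealNormCount K (p ^ e) + rho₀ p * idealNormCount K (p ^ (e - 1)) := by
        rw [abs_of_nonneg hc0', abs_of_nonneg (mul_nonneg hρ0 hc0)]
    _ ≤ ((e : ℝ) + 1) ^ 3 + 3 * (e : ℝ) ^ 3 := by
        gcongr
    _ ≤ 4 * ((e : ℝ) + 1) ^ 3 := by nlinarith [pow_le_pow_left₀ he0 (by linarith : (e:ℝ) ≤ e + 1) 3]


/-! ### C. Absolute convergence of `∑ h(n) n^{-3/4}` -/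

section Summability

/-- Elementary facts on `r_p = p^{-3/4}` (`p` prime): `0 < r_p ≤ 3/4`, `r_p² = p^{-3/2}`,
`p^{-1} ≤ r_p`. [folklore] -/
theorem rpow_neg34_facts {p : ℕ} (hp : p.Prime) :
    0 < (p : ℝ) ^ (-(3 / 4 : ℝ)) ∧ (p : ℝ) ^ (-(3 / 4 : ℝ)) ≤ 3 / 4 ∧
      ((p : ℝ) ^ (-(3 / 4 : ℝ))) ^ 2 = (p : ℝ) ^ (-(3 / 2 : ℝ)) ∧
      (p : ℝ)⁻¹ ≤ (p : ℝ) ^ (-(3 / 4 : ℝ)) := by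
  have hp2 : (2 : ℝ) ≤ p := by exact_mod_cast hp.two_le
  have hp0 : (0 : ℝ) < p := by linarith
  refine ⟨Real.rpow_pos_of_pos hp0 _, ?_, ?_, ?_⟩
  · have h1 : (p : ℝ) ^ (-(3 / 4 : ℝ)) ≤ (2 : ℝ) ^ (-(3 / 4 : ℝ)) :=
      Real.rpow_le_rpow_of_nonpos (by norm_num) hp2 (by norm_num)
    have h2 : (2 : ℝ) ^ (-(3 / 4 : ℝ)) ≤ 3 / 4 := by
      have h4 : ((2 : ℝ) ^ (-(3 / 4 : ℝ))) ^ 4 ≤ (3 / 4 : ℝ) ^ 4 := by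
        rw [← Real.rpow_natCast, ← Real.rpow_mul (by norm_num),
          show (-(3 / 4 : ℝ)) * ((4 : ℕ) : ℝ) = ((-3 : ℤ) : ℝ) by norm_num, Real.rpow_intCast]
        norm_num
      exact (pow_le_pow_iff_left₀ (Real.rpow_nonneg (by norm_num) _) (by norm_num)
        (by norm_num)).1 h4
    exact h1.trans h2
  · rw [← Real.rpow_natCast, ← Real.rpow_mul hp0.le]
    norm_num
  · rw [← Real.rpow_neg_one]
    exact Real.rpow_le_rpow_of_exponent_le (by linarith) (by norm_num)

/-- `∑_e 4(e+3)³ r^e` converges for `0 < r < 1`. [folklore] -/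
theorem summable_four_mul_cube_mul_geometric {r : ℝ} (hr0 : 0 < r) (hr : r < 1) :
    Summable fun e : ℕ => 4 * ((e : ℝ) + 3) ^ 3 * r ^ e := by
  have h := summable_pow_mul_geometric_of_norm_lt_one 3 (r := r)
    (by rwa [Real.norm_of_nonneg hr0.le])
  have h3 := (summable_nat_add_iff 3).2 h
  have heq : (fun e : ℕ => 4 * ((e : ℝ) + 3) ^ 3 * r ^ e) =
      fun e => (4 * (r ^ 3)⁻¹) * (((e + 3 : ℕ) : ℝ) ^ 3 * r ^ (e + 3)) := by
    funext e
    push_cast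
    field_simp
    ring
  rw [heq]
  exact h3.mul_left _

/-- The absolute constant `T₀ = ∑_e 4(e+3)³(3/4)^e`. [folklore] -/
def sigmaOneTailConst : ℝ := ∑' e : ℕ, 4 * ((e : ℝ) + 3) ^ 3 * (3 / 4 : ℝ) ^ e

/-- `T₀ ≥ 0`. [folklore] -/
theorem sigmaOneTailConst_nonneg : 0 ≤ sigmaOneTailConst :=
  tsum_nonneg fun e => by positivity

/-- `F(n) = |h(n)| n^{-3/4}`, the general term of `∑ |h(n)| n^{-σ}` at `σ = 3/4`. [folklore] -/
def sigmaOneF (n : ℕ) : ℝ := |sigmaOneNum n| * (n : ℝ) ^ (-(3 / 4 : ℝ))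

/-- `F ≥ 0`. [folklore] -/
theorem sigmaOneF_nonneg (n : ℕ) : 0 ≤ sigmaOneF n :=
  mul_nonneg (abs_nonneg _) (Real.rpow_nonneg (Nat.cast_nonneg _) _)

/-- `F(0) = 0`. [folklore] -/
theorem sigmaOneF_zero : sigmaOneF 0 = 0 := by simp [sigmaOneF]

/-- `F(1) = 1`. [folklore] -/
theorem sigmaOneF_one : sigmaOneF 1 = 1 := by simp [sigmaOneF, sigmaOneNum_one]

/-- `F` is multiplicative on coprime arguments. [folklore] -/
theorem sigmaOneF_mul_of_coprime {m n : ℕ} (h : m.Coprime n) :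
    sigmaOneF (m * n) = sigmaOneF m * sigmaOneF n := by
  unfold sigmaOneF
  rw [isMultiplicative_sigmaOneNum.map_mul_of_coprime h, abs_mul, Nat.cast_mul,
    Real.mul_rpow (Nat.cast_nonneg _) (Nat.cast_nonneg _)]
  ring

/-- `F(p^e) = |h(p^e)| r_p^e`. [folklore] -/
theorem sigmaOneF_prime_pow (p e : ℕ) :
    sigmaOneF (p ^ e) = |sigmaOneNum (p ^ e)| * ((p : ℝ) ^ (-(3 / 4 : ℝ))) ^ e := by
  unfold sigmaOneF
  rw [Nat.cast_pow, Real.rpow_pow_comm (Nat.cast_nonneg _)]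

/-- Local summability: `∑_e F(p^e)` converges (domination by `4(e+1)³ r_p^e`). [folklore] -/
theorem summable_sigmaOneF_prime_pow {p : ℕ} (hp : p.Prime) :
    Summable fun e : ℕ => sigmaOneF (p ^ e) := by
  obtain ⟨hr0, hr34, -, -⟩ := rpow_neg34_facts hp
  set r : ℝ := (p : ℝ) ^ (-(3 / 4 : ℝ)) with hr
  have hr1 : r < 1 := by linarith
  have hdom := summable_four_mul_cube_mul_geometric hr0 hr1
  refine Summable.of_nonneg_of_le (fun e => sigmaOneF_nonneg _) (fun e => ?_) hdom
  rw [sigmaOneF_prime_pow]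
  have h1 := abs_sigmaOneNum_prime_pow_le hp e
  have he : 4 * ((e : ℝ) + 1) ^ 3 ≤ 4 * ((e : ℝ) + 3) ^ 3 := by
    gcongr; linarith
  calc |sigmaOneNum (p ^ e)| * r ^ e ≤ 4 * ((e : ℝ) + 1) ^ 3 * r ^ e :=
        mul_le_mul_of_nonneg_right h1 (pow_nonneg hr0.le _)
    _ ≤ 4 * ((e : ℝ) + 3) ^ 3 * r ^ e := mul_le_mul_of_nonneg_right he (pow_nonneg hr0.le _)

/-- **The local Euler factor of `F`**: `∑_e F(p^e) ≤ 1 + (3 + T₀) p^{-3/2}`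
(`F(p) = ν_p/(p+1) · p^{-3/4} ≤ 3p^{-7/4}`, `∑_{e≥2} F(p^e) ≤ r_p² ∑_e 4(e+3)³(3/4)^e`). [folklore] -/
theorem tsum_sigmaOneF_prime_pow_le {p : ℕ} (hp : p.Prime) :
    ∑' e : ℕ, sigmaOneF (p ^ e) ≤ 1 + (3 + sigmaOneTailConst) * (p : ℝ) ^ (-(3 / 2 : ℝ)) := by
  obtain ⟨hr0, hr34, hr2, hrinv⟩ := rpow_neg34_facts hp
  set r : ℝ := (p : ℝ) ^ (-(3 / 4 : ℝ)) with hr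
  have hp0 : (0 : ℝ) < p := by exact_mod_cast hp.pos
  have hsum := summable_sigmaOneF_prime_pow hp
  -- split off `e = 0, 1`
  rw [hsum.tsum_eq_zero_add, ((summable_nat_add_iff 1).2 hsum).tsum_eq_zero_add]
  simp only [zero_add, pow_zero, sigmaOneF_one, pow_one]
  -- `F(p) ≤ 3 r²`
  have hFp : sigmaOneF p ≤ 3 * r ^ 2 := by
    have h := sigmaOneF_prime_pow p 1
    rw [pow_one, pow_one] at h
    rw [h, sigmaOneNum_prime hp, abs_of_nonneg (by positivity)]
    have hν : (cubeRootTwoCount p : ℝ) ≤ 3 := by exact_mod_cast cubeRootTwoCount_le_three hp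
    calc (cubeRootTwoCount p : ℝ) / (p + 1) * r ≤ 3 / p * r := by
          gcongr
          · linarith
      _ = 3 * ((p : ℝ)⁻¹ * r) := by ring
      _ ≤ 3 * (r * r) := by gcongr
      _ = 3 * r ^ 2 := by ring
  -- the tail `e ≥ 2`
  have hgeo := summable_four_mul_cube_mul_geometric (by norm_num : (0 : ℝ) < 3 / 4) (by norm_num)
  have htail : ∑' e : ℕ, sigmaOneF (p ^ (e + 1 + 1)) ≤ r ^ 2 * sigmaOneTailConst := by
    rw [sigmaOneTailConst, ← tsum_mul_left]
    refine Summable.tsum_le_tsum (fun e => ?_) ((summable_nat_add_iff 2).2 hsum) (hgeo.mul_left _)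
    rw [show e + 1 + 1 = e + 2 by ring, sigmaOneF_prime_pow]
    show |sigmaOneNum (p ^ (e + 2))| * r ^ (e + 2) ≤ _
    have h1 := abs_sigmaOneNum_prime_pow_le hp (e + 2)
    have hre : r ^ e ≤ (3 / 4 : ℝ) ^ e := pow_le_pow_left₀ hr0.le hr34 e
    calc |sigmaOneNum (p ^ (e + 2))| * r ^ (e + 2)
        ≤ 4 * (((e + 2 : ℕ) : ℝ) + 1) ^ 3 * r ^ (e + 2) := by gcongr
      _ = r ^ 2 * (4 * ((e : ℝ) + 3) ^ 3 * r ^ e) := by push_cast; ring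
      _ ≤ r ^ 2 * (4 * ((e : ℝ) + 3) ^ 3 * (3 / 4 : ℝ) ^ e) := by gcongr
  rw [hr2] at hFp htail
  have := sigmaOneTailConst_nonneg
  nlinarith [Real.rpow_nonneg hp0.le (-(3 / 2 : ℝ))]

/-- The uniform bound for the finite Euler products of `F`:
`∏_{p<N} ∑_e F(p^e) ≤ exp((3 + T₀) ∑_n n^{-3/2})`. [folklore] -/
theorem prod_tsum_sigmaOneF_le (N : ℕ) :
    ∏ p ∈ Nat.primesBelow N, ∑' e : ℕ, sigmaOneF (p ^ e) ≤
      Real.exp ((3 + sigmaOneTailConst) * ∑' n : ℕ, (n : ℝ) ^ (-(3 / 2 : ℝ))) := by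
  have hZ : Summable fun n : ℕ => (n : ℝ) ^ (-(3 / 2 : ℝ)) :=
    Real.summable_nat_rpow.2 (by norm_num)
  set A : ℝ := 3 + sigmaOneTailConst with hA
  have hA0 : 0 ≤ A := by have := sigmaOneTailConst_nonneg; positivity
  calc ∏ p ∈ Nat.primesBelow N, ∑' e : ℕ, sigmaOneF (p ^ e)
      ≤ ∏ p ∈ Nat.primesBelow N, Real.exp (A * (p : ℝ) ^ (-(3 / 2 : ℝ))) := by
        refine prod_le_prod (fun p _ => tsum_nonneg fun e => sigmaOneF_nonneg _) fun p hp => ?_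
        have hp' := (Nat.mem_primesBelow.1 hp).2
        refine (tsum_sigmaOneF_prime_pow_le hp').trans ?_
        have := Real.add_one_le_exp (A * (p : ℝ) ^ (-(3 / 2 : ℝ)))
        linarith
    _ = Real.exp (∑ p ∈ Nat.primesBelow N, A * (p : ℝ) ^ (-(3 / 2 : ℝ))) := by
        rw [Real.exp_sum]
    _ ≤ Real.exp (A * ∑' n : ℕ, (n : ℝ) ^ (-(3 / 2 : ℝ))) := by
        refine Real.exp_le_exp.2 ?_
        rw [← mul_sum]
        refine mul_le_mul_of_nonneg_left ?_ hA0
        exact hZ.sum_le_tsum _ fun n _ => Real.rpow_nonneg (Nat.cast_nonneg _) _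

/-- The constant `B_h = exp((3 + T₀)∑_n n^{-3/2})` bounding `∑_n |h(n)| n^{-3/4}`. [folklore] -/
def sigmaOneNormBound : ℝ :=
  Real.exp ((3 + sigmaOneTailConst) * ∑' n : ℕ, (n : ℝ) ^ (-(3 / 2 : ℝ)))

/-- `B_h > 0`. [folklore] -/
theorem sigmaOneNormBound_pos : 0 < sigmaOneNormBound := Real.exp_pos _

/-- **`∑_n |h(n)| n^{-3/4}` converges, with sum at most `B_h`** ("`f₀(s)` has an Euler product
which converges absolutely and uniformly for `Re(s) ≥ 3/4`", p. 63). [cite: HeathBrownActa2001, §10 p. 63] -/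
theorem summable_sigmaOneF : Summable sigmaOneF ∧ ∑' n, sigmaOneF n ≤ sigmaOneNormBound :=
  summable_of_prod_tsum_le sigmaOneF_nonneg sigmaOneF_zero sigmaOneF_one
    (fun h => sigmaOneF_mul_of_coprime h) (fun hp => summable_sigmaOneF_prime_pow hp)
    prod_tsum_sigmaOneF_le

end Summability


/-! ### D. `f(s)ζ_K(s) = f₀(s)` and Perron's formula with the zero-free region -/

section Perron

open LSeries

/-- `∑ a(n) n^{-s}` converges absolutely for `Re s > 1` (`|a| ≤ c_K`). [folklore] -/
theorem LSeriesSummable_sigmaOneCoeff {s : ℂ} (hs : 1 < s.re) :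
    LSeriesSummable (fun n => (sigmaOneCoeff n : ℂ)) s := by
  refine Summable.of_norm_bounded (LFunctions.NumberField.LSeriesSummable_idealNormCount K hs).norm fun n => ?_
  refine norm_term_le s ?_
  rw [Complex.norm_real, Complex.norm_natCast, Real.norm_eq_abs]
  rcases eq_or_ne n 0 with rfl | hn
  · simp
  · have h := abs_sigmaOneCoeff_le n
    rwa [normCountAF_apply hn] at h

/-- **`f(s)ζ_K(s) = f₀(s)`** for `Re s > 1`: `(∑ a(n)n^{-s})·ζ_K(s) = ∑ h(n)n^{-s}`, `h = a ⋆ c_K`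
("`f(s) = ζ_K(s)^{-1}f₀(s)`", p. 63). [cite: HeathBrownActa2001, §10 p. 63] -/
theorem LSeries_sigmaOneCoeff_mul_dedekindZeta {s : ℂ} (hs : 1 < s.re) :
    LSeries (fun n => (sigmaOneCoeff n : ℂ)) s * NumberField.dedekindZeta K s =
      LSeries (fun n => (sigmaOneNum n : ℂ)) s := by
  rw [LFunctions.dedekindZeta_eq_LSeries, ← LSeries_convolution' (LSeriesSummable_sigmaOneCoeff hs)
    (LFunctions.NumberField.LSeriesSummable_idealNormCount K hs)]
  refine LSeries_congr (fun {n} hn => ?_) s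
  rw [LSeries.convolution_def, sigmaOneNum, ArithmeticFunction.mul_apply]
  push_cast
  refine Finset.sum_congr rfl fun x hx => ?_
  have hx2 : x.2 ≠ 0 := by
    have h := (Nat.mem_divisorsAntidiagonal.1 hx).1
    exact right_ne_zero_of_mul (h ▸ hn)
  rw [normCountAF_apply hx2, Complex.ofReal_natCast]

/-- `‖h(n) n^{-3/4}‖ = F(n)` for the terms of `∑ h(n) n^{-s}` at `s = 3/4`. [folklore] -/
theorem norm_term_sigmaOneNum (n : ℕ) :
    ‖term (fun n => (sigmaOneNum n : ℂ)) ((3 / 4 : ℝ) : ℂ) n‖ = sigmaOneF n := by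
  rw [norm_term_eq]
  rcases eq_or_ne n 0 with rfl | hn
  · rw [if_pos rfl, sigmaOneF_zero]
  · rw [if_neg hn, Complex.norm_real, Real.norm_eq_abs, Complex.ofReal_re, sigmaOneF,
      Real.rpow_neg (Nat.cast_nonneg _), div_eq_mul_inv]

/-- **Perron's formula and the zero-free region for `Σ₁`** (pp. 62–63: "`Σ₁ = (1/2πi)∫ f(s+1)L^s s^{-2} ds`
… we move the line of integration … `Σ₁ = Res{f(s+1)L^s s^{-2} : s = 0} + O(exp{−c(log L)^{1/2}})`"):
`|∑_{n ≤ x} a(n)n^{-1}log(x/n) − f₀(1)/γ₀| ≤ C exp(−c√(log x))` for `x ≥ 1`, from the tree's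
`logRieszMean_LSeries_div_dedekindZeta_bound` with `σ_h = 3/4`. [cite: HeathBrownActa2001, §10 pp. 62–63] -/
theorem sigmaOne_logRieszMean_bound :
    ∃ c : ℝ, 0 < c ∧ ∃ C : ℝ, 0 < C ∧ ∀ x : ℝ, 1 ≤ x →
      ‖(∑ n ∈ Finset.Icc 1 ⌊x⌋₊, (sigmaOneCoeff n : ℂ) / n * (Real.log (x / n) : ℂ)) -
          LSeries (fun n => (sigmaOneNum n : ℂ)) 1 / (NumberField.dedekindZeta_residue K : ℂ)‖ ≤
        C * Real.exp (-c * Real.sqrt (Real.log x)) := by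
  obtain ⟨c, hc, C, hC, h⟩ :=
    LFunctions.NumberField.logRieszMean_LSeries_div_dedekindZeta_bound K (σₕ := 3 / 4) (by norm_num)
  refine ⟨c, hc, C * sigmaOneNormBound, mul_pos hC sigmaOneNormBound_pos, fun x hx => ?_⟩
  have hh : LSeriesSummable (fun n => (sigmaOneNum n : ℂ)) ((3 / 4 : ℝ) : ℂ) :=
    Summable.of_norm (summable_sigmaOneF.1.congr fun n => (norm_term_sigmaOneNum n).symm)
  have hB : ∑' n, ‖term (fun n => (sigmaOneNum n : ℂ)) ((3 / 4 : ℝ) : ℂ) n‖ ≤ sigmaOneNormBound := by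
    rw [tsum_congr norm_term_sigmaOneNum]
    exact summable_sigmaOneF.2
  exact h _ _ sigmaOneNormBound hh hB
    (fun σ hσ => LSeriesSummable_sigmaOneCoeff (by simpa using hσ))
    (fun s hs => LSeries_sigmaOneCoeff_mul_dedekindZeta hs) x hx

end Perron

/-! ### E. The residue: `f₀(1) = ∑ h(n)/n = σ₀γ₀π²/6` -/

section Residue

/-- `f₀(1) = L(h, 1)` is the real number `∑_n h(n)/n`. [folklore] -/
theorem LSeries_sigmaOneNum_one :
    LSeries (fun n => (sigmaOneNum n : ℂ)) 1 = ((∑' n : ℕ, sigmaOneNum n / n : ℝ) : ℂ) := by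
  rw [LSeries, Complex.ofReal_tsum]
  refine tsum_congr fun n => ?_
  rcases eq_or_ne n 0 with rfl | hn
  · simp
  · rw [LSeries.term_of_ne_zero hn, Complex.cpow_one]
    push_cast
    rfl

/-- `h(n)/n` as a real arithmetic function. [folklore] -/
def sigmaOneQuot : ArithmeticFunction ℝ := ⟨fun n => sigmaOneNum n / n, by simp⟩

/-- `sigmaOneQuot n = h(n)/n`. [folklore] -/
theorem sigmaOneQuot_apply (n : ℕ) : sigmaOneQuot n = sigmaOneNum n / n := rfl

/-- `h(n)/n` is multiplicative. [folklore] -/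
theorem isMultiplicative_sigmaOneQuot : sigmaOneQuot.IsMultiplicative := by
  refine ⟨by simp [sigmaOneQuot_apply, sigmaOneNum_one], fun {m n} hmn => ?_⟩
  simp only [sigmaOneQuot_apply]
  rw [isMultiplicative_sigmaOneNum.map_mul_of_coprime hmn, Nat.cast_mul, mul_div_mul_comm]

/-- `∑ |h(n)|/n < ∞` (`1/n ≤ n^{-3/4}`). [folklore] -/
theorem summable_norm_sigmaOneQuot : Summable fun n => ‖sigmaOneQuot n‖ := by
  refine Summable.of_nonneg_of_le (fun n => norm_nonneg _) (fun n => ?_) summable_sigmaOneF.1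
  rw [sigmaOneQuot_apply, Real.norm_eq_abs, abs_div, Nat.abs_cast, sigmaOneF, div_eq_mul_inv]
  rcases eq_or_ne n 0 with rfl | hn
  · simp
  refine mul_le_mul_of_nonneg_left ?_ (abs_nonneg _)
  rw [← Real.rpow_neg_one]
  exact Real.rpow_le_rpow_of_exponent_le (by exact_mod_cast Nat.one_le_iff_ne_zero.2 hn)
    (by norm_num)

/-- **The Euler product for `f₀(1)`**: `∏_{p<N} ∑_e h(p^e)p^{-e} → ∑_n h(n)/n`. [folklore] -/
theorem tendsto_prod_tsum_sigmaOneQuot :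
    Tendsto (fun N : ℕ => ∏ p ∈ Nat.primesBelow N, ∑' e : ℕ, sigmaOneQuot (p ^ e)) atTop
      (𝓝 (∑' n : ℕ, sigmaOneNum n / n)) :=
  isMultiplicative_sigmaOneQuot.eulerProduct summable_norm_sigmaOneQuot

open UniqueFactorizationMonoid in
/-- A nonzero ideal all of whose prime factors lie above `p` has norm a power of `p`. [folklore] -/
theorem exists_absNorm_eq_pow_of_supported {p : ℕ} (hp : p.Prime) {D : Ideal (𝓞 K)} (hD : D ≠ ⊥)
    (h : ∀ Q ∈ normalizedFactors D, Q ∈ primesAbove p) :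
    ∃ j : ℕ, Ideal.absNorm D = p ^ j := by
  have hN0 : Ideal.absNorm D ≠ 0 := by rwa [Ne, Ideal.absNorm_eq_zero_iff]
  refine ⟨_, Nat.eq_prime_pow_of_unique_prime_dvd hN0 ?_⟩
  intro q hq hqN
  have hprod : Ideal.absNorm D = ((normalizedFactors D).map Ideal.absNorm).prod := by
    conv_lhs => rw [← Ideal.prod_normalizedFactors_eq_self hD]
    rw [map_multiset_prod]
  rw [hprod] at hqN
  obtain ⟨Q, hQ, hqQ⟩ := (Nat.prime_iff.mp hq).exists_mem_multiset_map_dvd hqN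
  obtain ⟨f, -, -, hf⟩ := exists_absNorm_eq_pow_of_mem_primesAbove hp (h Q hQ)
  rw [hf] at hqQ
  exact (Nat.prime_dvd_prime_iff_eq hq hp).1 (hq.dvd_of_dvd_pow hqQ)

open UniqueFactorizationMonoid in
/-- The ideals of norm `p^e` are exactly the nonzero ideals of norm `p^e` supported above `p`.
[folklore] -/
theorem card_supported_primesAbove_eq {p : ℕ} (hp : p.Prime) (e : ℕ) :
    Nat.card {D : Ideal (𝓞 K) // Ideal.absNorm D = p ^ e ∧
        (D ≠ ⊥ ∧ ∀ Q ∈ normalizedFactors D, Q ∈ primesAbove p)} = idealNormCount K (p ^ e) := by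
  rw [LFunctions.idealNormCount_def]
  refine Nat.card_congr (Equiv.subtypeEquivRight fun D => ⟨fun h => h.1, fun hDn => ⟨hDn, ?_, ?_⟩⟩)
  · rw [Ne, ← Ideal.absNorm_eq_zero_iff, hDn]
    exact pow_ne_zero _ hp.ne_zero
  · intro Q hQ
    have hD0 : D ≠ ⊥ := by
      rw [Ne, ← Ideal.absNorm_eq_zero_iff, hDn]; exact pow_ne_zero _ hp.ne_zero
    have hD0' : (D : Ideal (𝓞 K)) ≠ 0 := by rwa [Ne, Ideal.zero_eq_bot]
    have hQp : Prime Q := prime_of_normalized_factor Q hQ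
    have hQD : Q ∣ D := dvd_of_mem_normalizedFactors hQ
    have hQ0 : Q ≠ ⊥ := by rw [Ne, ← Ideal.zero_eq_bot]; exact hQp.ne_zero
    have hQ1 : Ideal.absNorm Q ≠ 1 := by
      rw [Ne, Ideal.absNorm_eq_one_iff]
      exact fun h1 => hQp.not_unit (Ideal.isUnit_iff.2 h1)
    have hNdvd : Ideal.absNorm Q ∣ p ^ e := by
      rw [← hDn]; exact Ideal.absNorm_dvd_absNorm_of_le (Ideal.le_of_dvd hQD)
    obtain ⟨j, -, hj⟩ := (Nat.dvd_prime_pow hp).1 hNdvd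
    have hj0 : j ≠ 0 := by rintro rfl; rw [pow_zero] at hj; exact hQ1 hj
    rw [mem_primesAbove_iff hp]
    exact ⟨Ideal.isPrime_of_prime hQp, hQ0, hj ▸ dvd_pow_self p hj0⟩

open UniqueFactorizationMonoid in
/-- **The local factor of `ζ_K` at `p`**: `∑_e c_K(p^e) p^{-e} = ∏_{P ∣ p} (1 − N(P)^{-1})^{-1}`
(the tree's finite Euler product over the ideals supported above `p`,
`hasSum_card_supported_mul_rpow`). [folklore] -/
theorem hasSum_idealNormCount_prime_pow_div {p : ℕ} (hp : p.Prime) :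
    HasSum (fun e : ℕ => (idealNormCount K (p ^ e) : ℝ) / (p : ℝ) ^ e)
      (∏ P ∈ primesAbove p, (1 - ((Ideal.absNorm P : ℕ) : ℝ)⁻¹)⁻¹) := by
  have hT : ∀ P ∈ primesAbove p, Prime P := fun P hP =>
    Ideal.prime_of_isPrime (isPrime_of_mem_primesAbove hP).2 (isPrime_of_mem_primesAbove hP).1
  have h := LFunctions.NumberField.hasSum_card_supported_mul_rpow (K := K) one_pos (primesAbove p) hT
  simp only [Real.rpow_neg_one] at h
  -- restrict to the powers of `p`
  have hinj : Function.Injective fun e : ℕ => p ^ e := Nat.pow_right_injective hp.two_le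
  rw [← hinj.hasSum_iff] at h
  · refine h.congr_fun fun e => ?_   -- (f ∘ g) e = ...
    simp only [Function.comp_def]
    rw [card_supported_primesAbove_eq hp e, Nat.cast_pow, div_eq_mul_inv]
  · intro n hn
    rw [Set.mem_range, not_exists] at hn
    rw [mul_eq_zero]
    left
    rw [Nat.cast_eq_zero, Nat.card_eq_zero]
    left
    refine ⟨fun ⟨D, hDn, hD0, hQ⟩ => ?_⟩
    obtain ⟨j, hj⟩ := exists_absNorm_eq_pow_of_supported hp hD0 hQ
    exact hn j (hj ▸ hDn)

/-- The local factor of `ζ_K` at `p` is `(1 − normDensityAt p)⁻¹ = ∏_{P∣p}(1 − N(P)⁻¹)⁻¹`. [folklore] -/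
theorem hasSum_idealNormCount_prime_pow_div' {p : ℕ} (hp : p.Prime) :
    HasSum (fun e : ℕ => (idealNormCount K (p ^ e) : ℝ) / (p : ℝ) ^ e) (1 - normDensityAt p)⁻¹ := by
  have h := hasSum_idealNormCount_prime_pow_div hp
  rwa [prod_inv_distrib, show ∏ P ∈ primesAbove p, (1 - ((Ideal.absNorm P : ℕ) : ℝ)⁻¹) =
    1 - normDensityAt p by rw [normDensityAt, sub_sub_cancel]] at h

/-- **The local factor of `f₀` at `p`**: `∑_e h(p^e)p^{-e} = (1 − ρ₀(p)/p)·∏_{P∣p}(1 − N(P)^{-1})^{-1}`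
(p. 63: the residue "`γ₀^{-1}∏_p{(1 − ρ₀(p)/p)… (1 − N(P)^{-1})^{-1}}`"). [cite: HeathBrownActa2001, §10 p. 63] -/
theorem tsum_sigmaOneQuot_prime_pow {p : ℕ} (hp : p.Prime) :
    ∑' e : ℕ, sigmaOneQuot (p ^ e) = (1 - densA p) * (1 - normDensityAt p)⁻¹ := by
  have hC := hasSum_idealNormCount_prime_pow_div' hp
  set Cp : ℝ := (1 - normDensityAt p)⁻¹ with hCp
  set cterm : ℕ → ℝ := fun e => (idealNormCount K (p ^ e) : ℝ) / (p : ℝ) ^ e with hct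
  -- the shifted sequence `0, cterm 0, cterm 1, …`
  set sh : ℕ → ℝ := fun e => if e = 0 then 0 else cterm (e - 1) with hsh
  have hsh' : HasSum sh Cp := by
    rw [← hasSum_nat_add_iff' 1]
    have h1 : (fun n : ℕ => sh (n + 1)) = cterm := by
      funext n; simp [hsh]
    have h2 : ∑ i ∈ Finset.range 1, sh i = 0 := by simp [hsh]
    rw [h1, h2, sub_zero]
    exact hC
  have hp0 : (0 : ℝ) < p := by exact_mod_cast hp.pos
  have hpt : ∀ e : ℕ, sigmaOneQuot (p ^ e) = cterm e - rho₀ p / p * sh e := by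
    intro e
    rcases eq_or_ne e 0 with rfl | he
    · simp [hsh, hct, sigmaOneQuot_apply, sigmaOneNum_one, LFunctions.idealNormCount_one]
    · rw [sigmaOneQuot_apply, sigmaOneNum_prime_pow hp he]
      simp only [hsh, hct, if_neg he]
      obtain ⟨k, rfl⟩ := Nat.exists_eq_succ_of_ne_zero he
      simp only [Nat.succ_sub_one, pow_succ]
      field_simp
      push_cast
      ring
  have hsum : HasSum (fun e : ℕ => sigmaOneQuot (p ^ e)) (Cp - rho₀ p / p * Cp) := by
    have := hC.sub (hsh'.mul_left (rho₀ p / p))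
    exact this.congr_fun fun e => hpt e
  rw [hsum.tsum_eq, rho₀_div_eq hp.pos, densA_prime hp]
  ring

/-- `∏_{p<N}` of the local factors of `f₀` is `V_𝒜(N)/V_ℬ(N)`. [folklore] -/
theorem prod_tsum_sigmaOneQuot_eq (N : ℕ) :
    ∏ p ∈ Nat.primesBelow N, ∑' e : ℕ, sigmaOneQuot (p ^ e) = prodA N / prodB N := by
  rw [prodA, prodB, Nat.ceil_natCast, div_eq_mul_inv, ← prod_inv_distrib, ← prod_mul_distrib]
  exact prod_congr rfl fun p hp => tsum_sigmaOneQuot_prime_pow (Nat.mem_primesBelow.1 hp).2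

/-- `V(N) e^γ log N → 1` (Mertens). [folklore] -/
theorem tendsto_mertensProd_mul_log :
    Tendsto (fun N : ℕ => mertensProd N * (Real.exp Real.eulerMascheroniConstant * Real.log N))
      atTop (𝓝 1) := by
  have hlog : Tendsto (fun N : ℕ => Real.log N) atTop atTop :=
    Real.tendsto_log_atTop.comp tendsto_natCast_atTop_atTop
  have h60 : Tendsto (fun N : ℕ => 60 / Real.log N) atTop (𝓝 0) := tendsto_const_nhds.div_atTop hlog
  rw [← tendsto_sub_nhds_zero_iff]   -- hmm name
  refine squeeze_zero_norm' ?_ h60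
  filter_upwards [tendsto_natCast_atTop_atTop.eventually (eventually_ge_atTop (Real.exp 14))] with N hN
  rw [Real.norm_eq_abs]
  exact abs_mertensProd_mul_sub_one_le hN

/-- `V_ℬ(N) e^γ γ₀ log N → 1` (Mertens for `K`, `mertensK_grouped`). [folklore] -/
theorem tendsto_prodB_mul_log :
    Tendsto (fun N : ℕ => prodB N *
      (Real.exp Real.eulerMascheroniConstant * gamma₀ * Real.log N)) atTop (𝓝 1) := by
  obtain ⟨C, z₀, h⟩ := mertensK_grouped
  have hlog : Tendsto (fun N : ℕ => Real.log N) atTop atTop :=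
    Real.tendsto_log_atTop.comp tendsto_natCast_atTop_atTop
  have hC : Tendsto (fun N : ℕ => C / Real.log N) atTop (𝓝 0) := tendsto_const_nhds.div_atTop hlog
  rw [← tendsto_sub_nhds_zero_iff]
  refine squeeze_zero_norm' ?_ hC
  filter_upwards [tendsto_natCast_atTop_atTop.eventually (eventually_ge_atTop z₀)] with N hN
  rw [Real.norm_eq_abs]
  exact h N hN

/-- **`V_𝒜(N)/V_ℬ(N) → σ₀γ₀π²/6`**, `σ₀ = lim ∏_{p<N}(1 − (ν_p−1)/p)` (from (6.7) `V_𝒜 = S·V·∏(1−p^{-2})^{-1}`,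
`∏_{p<N}(1 − p^{-2}) → 6/π²`, and the two Mertens theorems). [cite: HeathBrownActa2001, §6 (6.7)] -/
theorem tendsto_prodA_div_prodB {σ₀ : ℝ} (hσ : Tendsto singularProductPartial atTop (𝓝 σ₀)) :
    Tendsto (fun N : ℕ => prodA N / prodB N) atTop (𝓝 (σ₀ * gamma₀ * Real.pi ^ 2 / 6)) := by
  set G := Real.exp Real.eulerMascheroniConstant with hG
  have hG0 : 0 < G := Real.exp_pos _
  have hγ0 : 0 < gamma₀ := gamma₀_pos
  have hπ : (6 : ℝ) / Real.pi ^ 2 ≠ 0 := by positivity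
  have hinv : Tendsto (fun N : ℕ => (invSqProdNat N)⁻¹) atTop (𝓝 ((6 / Real.pi ^ 2)⁻¹)) :=
    tendsto_invSqProdNat.inv₀ hπ
  have hM := tendsto_mertensProd_mul_log
  have hB := tendsto_prodB_mul_log
  -- the product of the four convergent factors
  have hall : Tendsto (fun N : ℕ => singularProductPartial N * (invSqProdNat N)⁻¹ * gamma₀ *
      (mertensProd N * (G * Real.log N)) / (prodB N * (G * gamma₀ * Real.log N))) atTop
      (𝓝 (σ₀ * (6 / Real.pi ^ 2)⁻¹ * gamma₀ * 1 / 1)) :=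
    (((hσ.mul hinv).mul tendsto_const_nhds).mul hM).div hB one_ne_zero
  rw [show σ₀ * gamma₀ * Real.pi ^ 2 / 6 = σ₀ * (6 / Real.pi ^ 2)⁻¹ * gamma₀ * 1 / 1 by
    field_simp]
  refine hall.congr' ?_
  filter_upwards [eventually_ge_atTop 2] with N hN
  have hlog : 0 < Real.log N := Real.log_pos (by exact_mod_cast hN)
  have hpB : 0 < prodB (N : ℝ) := (prodB_pos_le _).1
  rw [prodA_eq, invSqProd_eq, Nat.ceil_natCast]
  field_simp

/-- **The residue**: `f₀(1) = ∑_n h(n)/n = σ₀γ₀π²/6`, i.e. `γ₀^{-1}f₀(1) = (π²/6)σ₀` (p. 63).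
[cite: HeathBrownActa2001, §10 p. 63] -/
theorem tsum_sigmaOneQuot_eq {σ₀ : ℝ} (hσ : Tendsto singularProductPartial atTop (𝓝 σ₀)) :
    ∑' n : ℕ, sigmaOneNum n / n = σ₀ * gamma₀ * Real.pi ^ 2 / 6 := by
  refine tendsto_nhds_unique tendsto_prod_tsum_sigmaOneQuot ?_
  simp only [prod_tsum_sigmaOneQuot_eq]
  exact tendsto_prodA_div_prodB hσ

end Residue


/-! ### F. `Σ₁` as a sum over the ideals of square-free norm, and the theorem -/

section SigmaOne

/-- **`μ(J) = μ(N(J))` for `N(J)` square-free**: such a `J` is square-free and its prime ideal factors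
correspond through the norm to the prime factors of `N(J)` (p. 62: "we set `N(J) = q`, and observe that
`μ(J) = μ(q)`"). [cite: HeathBrownActa2001, §10 p. 62] -/
theorem idealMoebius_eq_moebius_absNorm {J : Ideal (𝓞 K)} (hJ : Squarefree (Ideal.absNorm J)) :
    idealMoebius J = (μ (Ideal.absNorm J) : ℝ) := by
  classical
  have hJ0 : J ≠ ⊥ := fun h => by
    rw [h, Ideal.absNorm_bot] at hJ; exact not_squarefree_zero hJ
  have hN0 : Ideal.absNorm J ≠ 0 := Squarefree.ne_zero hJ
  have hsqJ : Squarefree J := squarefree_of_squarefree_absNorm hJ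
  have hI := normSimple_of_squarefree_absNorm hJ
  have hcard : #(primeFactorsFinset J) = (Ideal.absNorm J).primeFactors.card := by
    rw [← hI.image_absNorm_primeFactorsFinset hJ0, card_image_of_injOn (hI.absNorm_injOn hJ0)]
  have hω : (Ideal.absNorm J).primeFactors.card =
      ArithmeticFunction.cardFactors (Ideal.absNorm J) := by
    rw [← (ArithmeticFunction.cardDistinctFactors_eq_cardFactors_iff_squarefree hN0).2 hJ,
      ArithmeticFunction.cardDistinctFactors_apply, Nat.primeFactors, List.card_toFinset]
  rw [idealMoebius, if_pos hsqJ, ArithmeticFunction.moebius_apply_of_squarefree hJ, hcard, hω]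
  push_cast
  ring

open scoped Classical in
/-- **`Σ₁` grouped by the norm** (p. 62: "`Σ₁ = ∑_{q≤L} ρ₀(q)μ(q)q^{-1}log(L/q)`"): the sum of
`μ(J)log(x/N(J))ρ₂(J)/N(J)` over the ideals `J` with `N(J) ≤ x` square-free equals
`∑_{n≤x} a(n)n^{-1}log(x/n)` (`∑_{N(J)=n}ρ₂(J)/N(J) = ρ₀(n)/n` for square-free `n`, and `μ(J) = μ(n)`).
[cite: HeathBrownActa2001, §10 p. 62] -/
theorem sigmaOne_sum_eq (x : ℝ) :
    ∑ J ∈ (idealsLE ⌊x⌋₊).filter (fun J => Squarefree (Ideal.absNorm J)),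
        idealMoebius J * Real.log (x / Ideal.absNorm J) * (rho₂ J / Ideal.absNorm J) =
      ∑ n ∈ Finset.Icc 1 ⌊x⌋₊, sigmaOneCoeff n / n * Real.log (x / n) := by
  set S := (idealsLE ⌊x⌋₊).filter (fun J => Squarefree (Ideal.absNorm J)) with hS
  have hmaps : ∀ J ∈ S, Ideal.absNorm J ∈ Finset.Icc 1 ⌊x⌋₊ := by
    intro J hJ
    rw [hS, mem_filter, mem_idealsLE] at hJ
    rw [Finset.mem_Icc]
    exact ⟨Nat.one_le_iff_ne_zero.2 (Squarefree.ne_zero hJ.2), hJ.1⟩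
  rw [← sum_fiberwise_of_maps_to hmaps]
  refine sum_congr rfl fun n hn => ?_
  have hn1 : 1 ≤ n := (Finset.mem_Icc.1 hn).1
  have hn0 : n ≠ 0 := by omega
  by_cases hsq : Squarefree n
  · have hfib : S.filter (fun J => Ideal.absNorm J = n) = normEq n := by
      ext J
      rw [mem_filter, hS, mem_filter, mem_idealsLE, mem_normEq]
      constructor
      · rintro ⟨-, h⟩; exact h
      · intro h; exact ⟨⟨h ▸ (Finset.mem_Icc.1 hn).2, h ▸ hsq⟩, h⟩
    rw [hfib]
    have hval : ∀ J ∈ normEq n,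
        idealMoebius J * Real.log (x / Ideal.absNorm J) * (rho₂ J / Ideal.absNorm J) =
          (μ n : ℝ) * Real.log (x / n) * (rho₂ J / Ideal.absNorm J) := by
      intro J hJ
      rw [mem_normEq] at hJ
      rw [idealMoebius_eq_moebius_absNorm (hJ ▸ hsq), hJ]
    rw [sum_congr rfl hval, ← mul_sum, sum_normEq_rho₂_div_eq_densA hsq, sigmaOneCoeff_apply hn0,
      densA_apply hn0, prod_div_distrib, ← Nat.cast_prod, Nat.prod_primeFactors_of_squarefree hsq]
    ring
  · have hfib : S.filter (fun J => Ideal.absNorm J = n) = ∅ := by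
      rw [Finset.filter_eq_empty_iff]
      intro J hJ hJn
      rw [hS, mem_filter] at hJ
      exact hsq (hJn ▸ hJ.2)
    rw [hfib, sum_empty, sigmaOneCoeff_eq_zero_of_not_squarefree hsq]
    simp

open scoped Classical in
/-- **Heath-Brown's `Σ₁ = (π²/6)σ₀ + O(exp{−c(log L)^{1/2}})`** (proof of Lemma 3.9, pp. 62–63): for the
singular series `σ₀ = ∏_p(1 − (ν_p−1)/p)` of the Theorem (the limit of its ordered partial products) there
are `c > 0`, `C > 0` with, for every `x ≥ 1`,
`|∑_{J : N(J) ≤ x, N(J) square-free} μ(J) ρ₂(J) N(J)^{-1} log(x/N(J)) − (π²/6)σ₀| ≤ C exp(−c√(log x))`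
(`ρ₂` of Lemma 3.2, `μ` the Möbius function on ideals; the sum is over `J ∈ 𝒯r`, the ideals with
square-free norm). Perron's formula for `f(s+1)x^s s^{-2}`, `f(s) = ∑ρ₀(q)μ(q)q^{-s} = ζ_K(s)^{-1}f₀(s)`, the
standard zero-free region for `ζ_K`, and the residue `γ₀^{-1}f₀(1) = (π²/6)σ₀`.
[cite: HeathBrownActa2001, §10 pp. 62–63] -/
theorem HeathBrown2001_sigmaOne_bound {σ₀ : ℝ} (hσ : Tendsto singularProductPartial atTop (𝓝 σ₀)) :
    ∃ c : ℝ, 0 < c ∧ ∃ C : ℝ, 0 < C ∧ ∀ x : ℝ, 1 ≤ x →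
      |(∑ J ∈ (idealsLE ⌊x⌋₊).filter (fun J => Squarefree (Ideal.absNorm J)),
          idealMoebius J * Real.log (x / Ideal.absNorm J) * (rho₂ J / Ideal.absNorm J)) -
        Real.pi ^ 2 / 6 * σ₀| ≤ C * Real.exp (-c * Real.sqrt (Real.log x)) := by
  obtain ⟨c, hc, C, hC, h⟩ := sigmaOne_logRieszMean_bound
  refine ⟨c, hc, C, hC, fun x hx => ?_⟩
  have hx' := h x hx
  have hγ0 : gamma₀ ≠ 0 := gamma₀_pos.ne'
  have hγ : (NumberField.dedekindZeta_residue K : ℂ) = (gamma₀ : ℂ) := rfl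
  have key : LSeries (fun n => (sigmaOneNum n : ℂ)) 1 / (NumberField.dedekindZeta_residue K : ℂ) =
      ((Real.pi ^ 2 / 6 * σ₀ : ℝ) : ℂ) := by
    rw [LSeries_sigmaOneNum_one, tsum_sigmaOneQuot_eq hσ, hγ, ← Complex.ofReal_div]
    congr 1
    field_simp
  have hS : (∑ n ∈ Finset.Icc 1 ⌊x⌋₊, (sigmaOneCoeff n : ℂ) / n * (Real.log (x / n) : ℂ)) =
      ((∑ n ∈ Finset.Icc 1 ⌊x⌋₊, sigmaOneCoeff n / n * Real.log (x / n) : ℝ) : ℂ) := by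
    push_cast
    rfl
  rw [key, hS, ← Complex.ofReal_sub, Complex.norm_real, Real.norm_eq_abs, ← sigmaOne_sum_eq] at hx'
  exact hx'

open scoped Classical in
/-- The same with the strict condition `N(J) < x` (the terms with `N(J) = x` vanish), the form
`Σ₁ = ∑_{J ∈ 𝒯r, N(J) < L} μ(J)ρ₂(J)N(J)^{-1}log(L/N(J))` in which `Σ₁` arises from (3.12).
[cite: HeathBrownActa2001, §10 pp. 62–63] -/
theorem HeathBrown2001_sigmaOne_bound' {σ₀ : ℝ} (hσ : Tendsto singularProductPartial atTop (𝓝 σ₀)) :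
    ∃ c : ℝ, 0 < c ∧ ∃ C : ℝ, 0 < C ∧ ∀ x : ℝ, 1 ≤ x →
      |(∑ J ∈ (idealsLE ⌊x⌋₊).filter
          (fun J => (Ideal.absNorm J : ℝ) < x ∧ Squarefree (Ideal.absNorm J)),
          idealMoebius J * Real.log (x / Ideal.absNorm J) * (rho₂ J / Ideal.absNorm J)) -
        Real.pi ^ 2 / 6 * σ₀| ≤ C * Real.exp (-c * Real.sqrt (Real.log x)) := by
  obtain ⟨c, hc, C, hC, h⟩ := HeathBrown2001_sigmaOne_bound hσ
  refine ⟨c, hc, C, hC, fun x hx => ?_⟩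
  have hsub : (idealsLE ⌊x⌋₊).filter
      (fun J => (Ideal.absNorm J : ℝ) < x ∧ Squarefree (Ideal.absNorm J)) ⊆
      (idealsLE ⌊x⌋₊).filter (fun J => Squarefree (Ideal.absNorm J)) :=
    fun J hJ => by
      rw [mem_filter] at hJ ⊢
      exact ⟨hJ.1, hJ.2.2⟩
  rw [Finset.sum_subset hsub]
  · exact h x hx
  · intro J hJ hJ'
    rw [mem_filter] at hJ
    rw [mem_filter, not_and, not_and'] at hJ'
    have hge : x ≤ (Ideal.absNorm J : ℝ) := not_lt.1 (hJ' hJ.1 hJ.2)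
    have hJx : Ideal.absNorm J ≤ ⌊x⌋₊ := mem_idealsLE.1 hJ.1
    have hle : (Ideal.absNorm J : ℝ) ≤ x :=
      le_trans (by exact_mod_cast hJx) (Nat.floor_le (by linarith))
    have heq : (Ideal.absNorm J : ℝ) = x := le_antisymm hle hge
    rw [heq, div_self (by linarith), Real.log_one, mul_zero, zero_mul]

end SigmaOne

end Literature.NumberTheory.Sieve.CubicSieve

end
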